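import Literature.NumberTheory.NumberFields.AmbiguousClassNumberFormula
import Literature.NumberTheory.IwasawaTheory.ClassicalMuInvariant
import Literature.NumberTheory.EllipticCurves.ZpExtensionLayersLocalSymbolProofs
import HarnessLib

/-!
# `μ = 0` (indeed `A_n = 0` for all `n`) from the class number of `K` and the unit norm index of the
# FIRST layer: Chevalley's ambiguous class number formula in a `ℤ_p`-tower with any number of primes above `p`

Topic `NumberTheory/IwasawaTheory` (namespace = path).  THEOREMS ONLY (no definition, no named fact, no
instance; D-0026); everything here is proved from tree theorems, modulo the named fact
`fukuda1994_thm1_classNumberPExp_const_of_succ_eq` of `ClassicalMuInvariant.lean` where it is taken as an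
explicit hypothesis.

## Why (cell `bsd-potss`, seat `conjA-anchor` g12; `--supports` stmt-BirchSwinnertonDyer-19386 / 19413)

Road (b) of the Coates–Sujatha residue skeletons («classical `μ = 0` of `ℚ(E[p])_cyc` ⇒ statement (A)»)
is fed, per curve, by `μ = 0` for small number fields `K ⊆ ℚ(E[p])` (`K = ℚ(P)`, …).  The two class-group
doors of the tree are Iwasawa 1956 (`p ∤ h_K` and ONE prime of `K` above `p`,
`iwasawa1956_classNumberPExp_eq_zero_of_not_dvd_classNumber_of_unique_prime_holds`) and Fukuda 1994 (two
consecutive layers with the same `ord_p h`).  For the `p = 5` rows of the census whose mod-`5` image is the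
normaliser of a non-split Cartan subgroup or of `S₄`-type, `K = ℚ(P)` has degree `24` and TWO primes above
`5` (seat g9/g10): the first door is shut and the second needs `h` of a field of degree `120`.  This file
opens a third door, valid for ANY number `s` of primes above `p`: Chevalley's ambiguous class number formula
(Lang, *Cyclotomic Fields I–II*, Ch. 13 §4 Lemma 4.1 — a TREE THEOREM,
`AmbiguousClass.ambiguousClassNumberFormula`) for the first layer `K₁/K`, which is cyclic of degree `p`:

  `#Cl(K₁)^G · p · [E_K : E_K ∩ N_{K₁/K} K₁ˣ] = h_K · ∏_𝔭 e_𝔭 · e_∞ = h_K · p^t`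

(`t` = number of primes of `K` ramified in `K₁`, each then totally ramified; `e_∞ = 1` as `p` is odd).
Hence **`p ∤ h_K` and `[E_K : E_K ∩ N_{K₁/K} K₁ˣ] · p = p^s` with `t ≤ s` force `t = s`, `#Cl(K₁)^G = h_K`
and — by the fixed-point congruence for the `p`-group `G` acting on `Cl(K₁)[p]` — `p ∤ h(K₁)`**; with
Fukuda's Thm. 1 (1) and his index `n₀ = 0` this gives `e_n = ord_p h(K_n) = 0` for every `n`, so
`ClassicalMuVanishes`.  The per-row datum is thus `h_K` plus the norm index of the units of `K` from the
first layer, a quantity decided by local norm symbols at the primes above `p` (a global norm is a local norm).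

## Main results

* `AmbiguousClass.not_dvd_classNumber_of_isPGroup_of_not_dvd_card_fixed` — for a Galois `p`-extension
  `L/K` of number fields: `p ∤ #Cl(L)^G ⟹ p ∤ h_L` (orbit count of `G` on `Cl(L)[p]`);
* `AmbiguousClass.card_fixed_eq_classNumber_of_relIndex_mul_eq` — `L/K` Galois of odd prime degree `p`,
  `p ∤ h_K`, `[E_K : E_K ∩ N Lˣ] · p = p^s` with `#{𝔭 ramified} ≤ s`: then `#Cl(L)^G = h_K`;
* **`AmbiguousClass.not_dvd_classNumber_of_prime_finrank_of_relIndex_mul_eq`** — … hence `p ∤ h_L`;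
* `IwasawaTheory.ncard_ramified_layer_le_of_ncard_eq` — in a `ℤ_p`-tower the primes of `K` ramified in a
  layer lie above `p` (tree `ZpExtension.isUnramifiedIn_layer_of_not_mem`), so their number is at most the
  number `s` of primes above `p`;
* **`IwasawaTheory.classNumberPExp_one_eq_zero_of_relIndex_mul_eq`** — `e_1 = 0` from `p ∤ h_K`, `s` primes
  above `p` and unit norm index `p^{s-1}` from the first layer (unconditional);
* **`IwasawaTheory.classNumberPExp_eq_zero_of_relIndex_mul_eq`**,
  **`IwasawaTheory.classicalMuVanishes_of_relIndex_mul_eq`** — with Fukuda's Thm. 1 (1) (named fact, as a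
  hypothesis) and `TotallyRamifiedFrom κ 0`: `e_n = 0` for all `n`, hence `μ = 0` in growth form;
* `IwasawaTheory.forall_classicalMuVanishes_of_relIndex_mul_eq` — the consumer form
  «`∀ κ` cyclotomic, `ClassicalMuVanishes κ`» used by the `μ`-roads of the cell.

## References

* S. Lang, *Cyclotomic Fields I and II*, GTM 121 (1990), Ch. 13 §4, Lemma 4.1 (held copy, PDF p. 203);
  formalised in `NumberFields/AmbiguousClassNumberFormula.lean`. [Lang1990]
* T. Fukuda, *Remarks on `ℤ_p`-extensions of number fields*, Proc. Japan Acad. 70 A (1994), Thm. 1 (1),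
  p. 264 (named fact `fukuda1994_thm1_classNumberPExp_const_of_succ_eq`). [Fukuda1994]
* R. Greenberg, *Iwasawa theory — past and present* (2001), Prop. 2.1 p. 339 (the one-prime case). [Greenberg2001IwasawaPastPresent]
* L. Washington, *Introduction to Cyclotomic Fields*, 2nd ed. (1997), §13.1 and Prop. 13.2 (layers are
  unramified outside `p`; as cited by the tree theorem used). [Washington1997]
-/

noncomputable section

open NumberField IsDedekindDomain
open scoped nonZeroDivisors

/-! ## §1 Number fields: Chevalley's formula in prime degree and the fixed-point congruence -/

namespace Literature.NumberTheory.NumberFields.AmbiguousClass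

open Literature.NumberTheory.GaloisRepresentations Literature.NumberTheory.GaloisRepresentations.Herbrand
  Literature.NumberTheory.GaloisRepresentations.MinkowskiUnit
  Literature.NumberTheory.GaloisRepresentations.CyclicNormIndex

variable {K L : Type} [Field K] [NumberField K] [Field L] [NumberField L] [Algebra K L]

omit [NumberField K] in
/-- **`p ∤ #Cl(L)^G ⟹ p ∤ h_L` for a Galois `p`-extension `L/K`.**  If `p ∣ h_L`, Cauchy gives a class of
order `p`, so the `p`-torsion `X = Cl(L)[p]` is a non-trivial elementary `p`-group, `#X ≡ 0 (mod p)`; the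
`p`-group `G = Gal(L/K)` acts on `X` (by `[I] ↦ [σI]`, `ClassGroup.mulEquiv (intAut σ)`) and
`#X ≡ #X^G (mod p)` (orbit count); but a fixed class of order dividing `p` lies in the subgroup `Cl(L)^G` of
order prime to `p`, so it is trivial and `#X^G = 1` — a contradiction.  (The step «`C^G` prime to `p` ⇒ `C`
prime to `p`» of every genus-theory argument, e.g. Lang Ch. 13 §4 after Lemma 4.1.) [folklore]
[cite: Lang1990, Ch. 13 §4, Lemma 4.1 (PDF p. 203)] -/
theorem not_dvd_classNumber_of_isPGroup_of_not_dvd_card_fixed {p : ℕ} [hp : Fact p.Prime]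
    (hG : IsPGroup p (L ≃ₐ[K] L))
    (hfix : ¬ p ∣ Nat.card {c : ClassGroup (𝓞 L) // ∀ τ : L ≃ₐ[K] L, ClassGroup.mulEquiv (intAut τ) c = c}) :
    ¬ p ∣ classNumber L := by
  classical
  intro hdvd
  -- the subgroup of fixed classes and its order
  obtain ⟨H, hH⟩ := isSubgroup_fixed (K := K) (L := L)
  have hcardH : Nat.card H =
      Nat.card {c : ClassGroup (𝓞 L) // ∀ τ : L ≃ₐ[K] L, ClassGroup.mulEquiv (intAut τ) c = c} :=
    Nat.card_congr (Equiv.setCongr hH)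
  -- the `p`-torsion `X = Cl(L)[p]`, with the Galois action
  let X : Type := {c : ClassGroup (𝓞 L) // c ^ p = 1}
  letI : MulAction (L ≃ₐ[K] L) X :=
    { smul := fun τ c => ⟨ClassGroup.mulEquiv (intAut τ) c.1, by rw [← map_pow, c.2, map_one]⟩
      one_smul := fun c => Subtype.ext (by
        change ClassGroup.mulEquiv (intAut (1 : L ≃ₐ[K] L)) c.1 = c.1
        rw [mulEquiv_intAut_one]; rfl)
      mul_smul := fun σ τ c => Subtype.ext (by
        change ClassGroup.mulEquiv (intAut (σ * τ)) c.1 =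
          ClassGroup.mulEquiv (intAut σ) (ClassGroup.mulEquiv (intAut τ) c.1)
        rw [mulEquiv_intAut_mul]; rfl) }
  haveI : Finite X := Subtype.finite
  -- (a) the fixed points of `G` on `X` are trivial
  have hfixX : Nat.card (MulAction.fixedPoints (L ≃ₐ[K] L) X) = 1 := by
    rw [Nat.card_eq_one_iff_unique]
    refine ⟨⟨fun a b => ?_⟩, ⟨⟨⟨1, one_pow p⟩, fun τ => Subtype.ext (map_one _)⟩⟩⟩
    -- a fixed element of `X` is `1`
    have key : ∀ c : MulAction.fixedPoints (L ≃ₐ[K] L) X, (c : X).1 = 1 := by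
      intro c
      have hcH : (c : X).1 ∈ H := by
        rw [← SetLike.mem_coe, hH]
        exact fun τ => congrArg Subtype.val (c.2 τ)
      -- its order divides `p` and `#H`, which is prime to `p`
      have h1 : orderOf (⟨(c : X).1, hcH⟩ : H) ∣ p := by
        rw [orderOf_dvd_iff_pow_eq_one]
        exact Subtype.ext (c : X).2
      have h2 : orderOf (⟨(c : X).1, hcH⟩ : H) ∣ Nat.card H := orderOf_dvd_natCard _
      have h3 : orderOf (⟨(c : X).1, hcH⟩ : H) = 1 := by
        rcases (Nat.dvd_prime hp.out).mp h1 with h | h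
        · exact h
        · exfalso
          rw [h, hcardH] at h2
          exact hfix h2
      have h4 := orderOf_eq_one_iff.mp h3
      exact congrArg Subtype.val h4
    exact Subtype.ext (Subtype.ext ((key a).trans (key b).symm))
  -- (b) `X` is a `p`-group of order divisible by `p`
  let Xs : Subgroup (ClassGroup (𝓞 L)) := (powMonoidHom p).ker
  have hXs : ∀ c : ClassGroup (𝓞 L), c ∈ Xs ↔ c ^ p = 1 := fun c => by
    rw [MonoidHom.mem_ker, powMonoidHom_apply]
  have hcardX : Nat.card X = Nat.card Xs :=
    Nat.card_congr (Equiv.subtypeEquivRight fun c => (hXs c).symm)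
  have hPX : IsPGroup p Xs := fun g => ⟨1, by
    rw [pow_one]
    exact Subtype.ext ((hXs g.1).mp g.2)⟩
  have hpX : p ∣ Nat.card X := by
    rw [hcardX]
    rcases hPX.card_eq_or_dvd with h | h
    · exfalso
      -- Cauchy: a class of order `p` is a non-trivial element of `Xs`
      have hdvd' : p ∣ Fintype.card (ClassGroup (𝓞 L)) := by rwa [classNumber] at hdvd
      obtain ⟨c, hc⟩ := exists_prime_orderOf_dvd_card p hdvd'
      have hcX : c ∈ Xs := (hXs c).mpr (hc ▸ pow_orderOf_eq_one c)
      haveI : Subsingleton Xs := (Nat.card_eq_one_iff_unique.mp h).1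
      have hc1 : c = 1 := congrArg Subtype.val (Subsingleton.elim (⟨c, hcX⟩ : Xs) 1)
      rw [hc1, orderOf_one] at hc
      exact hp.out.one_lt.ne' hc.symm
    · exact h
  -- (c) the orbit congruence `#X ≡ #X^G (mod p)` gives `p ∣ 1`
  have hmod := hG.card_modEq_card_fixedPoints X
  rw [hfixX] at hmod
  have h10 : 1 ≡ 0 [MOD p] := hmod.symm.trans (Nat.modEq_zero_iff_dvd.mpr hpX)
  exact hp.out.one_lt.ne' (Nat.dvd_one.mp (Nat.modEq_zero_iff_dvd.mp h10))

/-- **Chevalley in odd prime degree: `#Cl(L)^G = h_K`.**  Let `L/K` be a Galois extension of number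
fields of odd prime degree `p` (so cyclic, unramified at the infinite places, and every ramified prime
totally ramified: `∏_𝔭 e_𝔭 = p^t`, `t` the number of ramified primes, tree
`finprod_ramificationIdxIn_eq_pow_of_prime`).  If `p ∤ h_K` and the norm index of the units satisfies
`[E_K : E_K ∩ N_{L/K} Lˣ] · p = p^s` for some `s ≥ t`, then Lang's Lemma 4.1
(`ambiguousClassNumberFormula`) reads `#Cl(L)^G · p^s = h_K · p^t`, whence `s = t` and `#Cl(L)^G = h_K`.
[cite: Lang1990, Ch. 13 §4, Lemma 4.1 (PDF p. 203)] -/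
theorem card_fixed_eq_classNumber_of_relIndex_mul_eq [IsGalois K L] {p : ℕ} (hp : p.Prime)
    (hodd : Odd p) (hdeg : Module.finrank K L = p) (hK : ¬ p ∣ classNumber K) {s : ℕ}
    (hs : {v : HeightOneSpectrum (𝓞 K) | v.asIdeal.ramificationIdxIn (𝓞 L) ≠ 1}.ncard ≤ s)
    (hidx : (unitsE L ⊓ (⊤ : Subgroup Lˣ).map (Herbrand.norm (L ≃ₐ[K] L))).relIndex
        (unitsE L ⊓ (unitsIncl K L).range) * p = p ^ s) :
    Nat.card {c : ClassGroup (𝓞 L) // ∀ τ : L ≃ₐ[K] L, ClassGroup.mulEquiv (intAut τ) c = c} =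
      classNumber K := by
  classical
  haveI : FiniteDimensional K L := Module.Finite.of_restrictScalars_finite ℚ K L
  -- `Gal(L/K)` is cyclic of order `p`: pick a generator
  have hcard : Nat.card (L ≃ₐ[K] L) = p := by rw [IsGalois.card_aut_eq_finrank, hdeg]
  haveI : Fact p.Prime := ⟨hp⟩
  haveI : IsCyclic (L ≃ₐ[K] L) := isCyclic_of_prime_card hcard
  obtain ⟨σ, hσ⟩ := IsCyclic.exists_generator (α := L ≃ₐ[K] L)
  haveI : IsUnramifiedAtInfinitePlaces K L := IsUnramifiedAtInfinitePlaces_of_odd_finrank (hdeg ▸ hodd)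
  have h := ambiguousClassNumberFormula hσ
  rw [archFactor_eq_one, mul_one, finprod_ramificationIdxIn_eq_pow_of_prime hp hdeg,
    hdeg, mul_assoc, mul_comm p, hidx] at h
  -- `#Fix · p^s = h_K · p^t` with `t ≤ s` and `p ∤ h_K`
  set t := {v : HeightOneSpectrum (𝓞 K) | v.asIdeal.ramificationIdxIn (𝓞 L) ≠ 1}.ncard with ht
  set F := Nat.card {c : ClassGroup (𝓞 L) // ∀ τ : L ≃ₐ[K] L, ClassGroup.mulEquiv (intAut τ) c = c}
    with hF
  obtain ⟨d, hd⟩ := Nat.exists_eq_add_of_le hs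
  rw [hd, pow_add, ← mul_assoc] at h
  -- `F · p^t · p^d = h_K · p^t` ⟹ `F · p^d = h_K`
  have hpt : 0 < p ^ t := pow_pos hp.pos t
  have h' : F * p ^ d = classNumber K := by
    have h2 : F * p ^ d * p ^ t = classNumber K * p ^ t := by rw [← h]; ring
    exact Nat.eq_of_mul_eq_mul_right hpt h2
  -- `p ∤ h_K` forces `d = 0`
  rcases d with _ | e
  · rwa [pow_zero, mul_one] at h'
  · exfalso
    exact hK ⟨F * p ^ e, by rw [← h', pow_succ]; ring⟩

/-- **The unit norm-index criterion in odd prime degree: `p ∤ h_L`.**  Let `L/K` be Galois of odd prime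
degree `p` with `p ∤ h_K`; if the number of primes of `K` ramified in `L` is at most `s` and
`[E_K : E_K ∩ N_{L/K} Lˣ] · p = p^s` (i.e. the units of `K` have norm index `p^{s-1}` from `L`, `s ≥ 1`),
then `p ∤ h_L`: Chevalley's formula gives `#Cl(L)^G = h_K`, prime to `p`
(`card_fixed_eq_classNumber_of_relIndex_mul_eq`), and the fixed-point congruence finishes
(`not_dvd_classNumber_of_isPGroup_of_not_dvd_card_fixed`).  With `s = 1` (one ramified prime, index `1`)
this is the prime-degree case of Iwasawa's one-prime lemma (Washington Thm. 10.4 / Greenberg Prop. 2.1),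
here obtained for any number of ramified primes. [cite: Lang1990, Ch. 13 §4, Lemma 4.1 (PDF p. 203)]
[cite: Greenberg2001IwasawaPastPresent, Prop. 2.1 p. 339 (the case s = 1)] -/
theorem not_dvd_classNumber_of_prime_finrank_of_relIndex_mul_eq [IsGalois K L] {p : ℕ} (hp : p.Prime)
    (hodd : Odd p) (hdeg : Module.finrank K L = p) (hK : ¬ p ∣ classNumber K) {s : ℕ}
    (hs : {v : HeightOneSpectrum (𝓞 K) | v.asIdeal.ramificationIdxIn (𝓞 L) ≠ 1}.ncard ≤ s)
    (hidx : (unitsE L ⊓ (⊤ : Subgroup Lˣ).map (Herbrand.norm (L ≃ₐ[K] L))).relIndex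
        (unitsE L ⊓ (unitsIncl K L).range) * p = p ^ s) :
    ¬ p ∣ classNumber L := by
  haveI : FiniteDimensional K L := Module.Finite.of_restrictScalars_finite ℚ K L
  haveI : Fact p.Prime := ⟨hp⟩
  have hG : IsPGroup p (L ≃ₐ[K] L) :=
    IsPGroup.of_card (n := 1) (by rw [pow_one, IsGalois.card_aut_eq_finrank, hdeg])
  refine not_dvd_classNumber_of_isPGroup_of_not_dvd_card_fixed hG ?_
  rw [card_fixed_eq_classNumber_of_relIndex_mul_eq hp hodd hdeg hK hs hidx]
  exact hK

end Literature.NumberTheory.NumberFields.AmbiguousClass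

/-! ## §2 `ℤ_p`-towers: the first layer, then every layer -/

namespace Literature.NumberTheory.IwasawaTheory

open Literature.NumberTheory.EllipticCurves Literature.NumberTheory.NumberFields.AmbiguousClass
  Literature.NumberTheory.GaloisRepresentations Literature.NumberTheory.GaloisRepresentations.Herbrand
  Literature.NumberTheory.GaloisRepresentations.MinkowskiUnit
  Literature.NumberTheory.GaloisRepresentations.CyclicNormIndex

variable {K : Type} [Field K] [NumberField K] {p : ℕ} [Fact p.Prime]

/-- **In a `ℤ_p`-tower the primes of `K` ramified in a layer `K_n` lie above `p`**, so if `K` has `s`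
primes above `p` then at most `s` primes ramify in `K_n/K` (tree `ZpExtension.isUnramifiedIn_layer_of_not_mem`,
Washington Prop. 13.2, turned into `e_𝔭 = 1` by Mathlib's `Algebra.IsUnramifiedIn.ramificationIdx_eq_one`).
[cite: Washington1997, §13.1 Prop. 13.2] -/
theorem ncard_ramified_layer_le_of_ncard_eq (κ : ZpExtension K p) (n : ℕ) [NumberField (κ.layer n)]
    {s : ℕ} (hs : {v : HeightOneSpectrum (𝓞 K) | ((p : ℕ) : 𝓞 K) ∈ v.asIdeal}.ncard = s) :
    {v : HeightOneSpectrum (𝓞 K) | v.asIdeal.ramificationIdxIn (𝓞 (κ.layer n)) ≠ 1}.ncard ≤ s := by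
  classical
  haveI : FiniteDimensional K (κ.layer n) := κ.finiteDimensional_layer_holds n
  haveI : IsGalois K (κ.layer n) := κ.isGalois_layer_holds n
  -- the primes above `p` form a finite set
  have hp0 : Ideal.span {((p : ℕ) : 𝓞 K)} ≠ ⊥ := by
    rw [Ne, Ideal.span_singleton_eq_bot]
    exact_mod_cast (Fact.out : p.Prime).ne_zero
  have hfin : {v : HeightOneSpectrum (𝓞 K) | ((p : ℕ) : 𝓞 K) ∈ v.asIdeal}.Finite := by
    refine (Ideal.finite_factors hp0).subset fun v hv => ?_
    exact (Ideal.dvd_span_singleton).mpr hv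
  rw [← hs]
  refine Set.ncard_le_ncard (fun v hv => ?_) hfin
  -- a prime `v ∤ p` is unramified in `K_n`, so `e_v = 1`
  by_contra hpv
  apply hv
  have hunr := κ.isUnramifiedIn_layer_of_not_mem n hpv
  haveI : v.asIdeal.IsPrime := v.isPrime
  obtain ⟨⟨P, hPprime, hPover⟩⟩ :=
    (inferInstance : Nonempty (Ideal.primesOver v.asIdeal (𝓞 (κ.layer n))))
  haveI := hPprime
  haveI := hPover
  rw [Ideal.ramificationIdxIn_eq_ramificationIdx v.asIdeal P (κ.layer n ≃ₐ[K] κ.layer n)]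
  exact hunr.ramificationIdx_eq_one hPover

/-- **`e_1 = 0` from the unit norm index of the first layer (unconditional).**  For a number field `K`, an
odd prime `p` with `p ∤ h_K`, `s` primes of `K` above `p`, and a `ℤ_p`-extension `κ` whose first layer
`K₁ = κ.layer 1` satisfies `[E_K : E_K ∩ N_{K₁/K} K₁ˣ] · p = p^s` (norm index `p^{s-1}`), the class number of
`K₁` is prime to `p`: `ord_p h(K₁) = 0`.  (`K₁/K` is Galois of degree `p`, tree
`ZpExtension.finrank_layer_holds` / `isGalois_layer_holds`; then §1.) [cite: Lang1990, Ch. 13 §4, Lemma 4.1 (PDF p. 203)] -/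
theorem classNumberPExp_one_eq_zero_of_relIndex_mul_eq (hp2 : p ≠ 2) (κ : ZpExtension K p)
    (hK : ¬ p ∣ classNumber K) {s : ℕ}
    (hs : {v : HeightOneSpectrum (𝓞 K) | ((p : ℕ) : 𝓞 K) ∈ v.asIdeal}.ncard = s)
    (hidx : haveI : FiniteDimensional K (κ.layer 1) := κ.finiteDimensional_layer_holds 1
      (unitsE (κ.layer 1) ⊓ (⊤ : Subgroup (κ.layer 1)ˣ).map
          (Herbrand.norm (κ.layer 1 ≃ₐ[K] κ.layer 1))).relIndex
        (unitsE (κ.layer 1) ⊓ (unitsIncl K (κ.layer 1)).range) * p = p ^ s) :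
    classNumberPExp κ 1 = 0 := by
  haveI : FiniteDimensional K (κ.layer 1) := κ.finiteDimensional_layer_holds 1
  haveI : IsGalois K (κ.layer 1) := κ.isGalois_layer_holds 1
  haveI : NumberField (κ.layer 1) := NumberField.of_module_finite K (κ.layer 1)
  have hp : p.Prime := Fact.out
  have hodd : Odd p := hp.odd_of_ne_two hp2
  have hdeg : Module.finrank K (κ.layer 1) = p := by rw [κ.finrank_layer_holds 1, pow_one]
  rw [classNumberPExp_eq_padicValNat_classNumber]
  refine padicValNat.eq_zero_of_not_dvd ?_
  exact not_dvd_classNumber_of_prime_finrank_of_relIndex_mul_eq hp hodd hdeg hK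
    (ncard_ramified_layer_le_of_ncard_eq κ 1 hs) hidx

/-- **`A_n = 0` for every `n` from `h_K` and the unit norm index of the first layer.**  Granted Fukuda's
Thm. 1 (1) (`hF1`, named fact of `ClassicalMuInvariant.lean`): for `K`, `p` odd, a `ℤ_p`-extension `κ` with
Fukuda's index `n₀ = 0` (`TotallyRamifiedFrom κ 0`), `p ∤ h_K`, `s` primes above `p` and first-layer unit norm
index `p^{s-1}` (`[E_K : E_K ∩ N_{K₁/K} K₁ˣ] · p = p^s`): `e_n(κ) = ord_p h(K_n) = 0` for all `n`
(`e_0 = e_1 = 0`, then Fukuda: `classNumberPExp_eq_zero_of_succ_eq_zero`).  For `s = 1` this is the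
conclusion of Iwasawa's one-prime lemma (Greenberg Prop. 2.1) — the index is then automatically `1`.
[cite: Lang1990, Ch. 13 §4, Lemma 4.1 (PDF p. 203)] [cite: Fukuda1994, Thm. 1 (1), p. 264]
[cite: Greenberg2001IwasawaPastPresent, Prop. 2.1 p. 339] -/
theorem classNumberPExp_eq_zero_of_relIndex_mul_eq (hF1 : fukuda1994_thm1_classNumberPExp_const_of_succ_eq)
    (hp2 : p ≠ 2) (κ : ZpExtension K p) (hram : TotallyRamifiedFrom κ 0) (hK : ¬ p ∣ classNumber K) {s : ℕ}
    (hs : {v : HeightOneSpectrum (𝓞 K) | ((p : ℕ) : 𝓞 K) ∈ v.asIdeal}.ncard = s)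
    (hidx : haveI : FiniteDimensional K (κ.layer 1) := κ.finiteDimensional_layer_holds 1
      (unitsE (κ.layer 1) ⊓ (⊤ : Subgroup (κ.layer 1)ˣ).map
          (Herbrand.norm (κ.layer 1 ≃ₐ[K] κ.layer 1))).relIndex
        (unitsE (κ.layer 1) ⊓ (unitsIncl K (κ.layer 1)).range) * p = p ^ s) (n : ℕ) :
    classNumberPExp κ n = 0 := by
  -- `e_0 = 0`: the bottom layer is `K`
  have h0 : classNumberPExp κ 0 = 0 := by
    haveI : FiniteDimensional K (κ.layer 0) := κ.finiteDimensional_layer_holds 0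
    haveI : NumberField (κ.layer 0) := NumberField.of_module_finite K (κ.layer 0)
    rw [classNumberPExp_eq_padicValNat_classNumber]
    refine padicValNat.eq_zero_of_not_dvd fun h => hK ?_
    -- `h(K_0) = h(K)`: `K_0 = ⊥ ≃ K`
    have e : (κ.layer 0) ≃ₐ[K] K :=
      (IntermediateField.equivOfEq κ.layer_zero).trans (IntermediateField.botEquiv K _)
    have hcl : classNumber (κ.layer 0) = classNumber K :=
      Fintype.card_congr (ClassGroup.mulEquiv (RingOfIntegers.mapRingEquiv e.toRingEquiv)).toEquiv
    rwa [hcl] at h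
  have h1 := classNumberPExp_one_eq_zero_of_relIndex_mul_eq hp2 κ hK hs hidx
  exact classNumberPExp_eq_zero_of_succ_eq_zero hF1 κ hram le_rfl h0 h1 (Nat.zero_le n)

/-- Corollary (growth form): under the same hypotheses `μ = 0` (`λ = ν = 0`, `n₀ = 0`), i.e.
`ClassicalMuVanishes κ`. [cite: Lang1990, Ch. 13 §4, Lemma 4.1 (PDF p. 203)] [cite: Fukuda1994, Thm. 1 (1), p. 264] -/
theorem classicalMuVanishes_of_relIndex_mul_eq (hF1 : fukuda1994_thm1_classNumberPExp_const_of_succ_eq)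
    (hp2 : p ≠ 2) (κ : ZpExtension K p) (hram : TotallyRamifiedFrom κ 0) (hK : ¬ p ∣ classNumber K) {s : ℕ}
    (hs : {v : HeightOneSpectrum (𝓞 K) | ((p : ℕ) : 𝓞 K) ∈ v.asIdeal}.ncard = s)
    (hidx : haveI : FiniteDimensional K (κ.layer 1) := κ.finiteDimensional_layer_holds 1
      (unitsE (κ.layer 1) ⊓ (⊤ : Subgroup (κ.layer 1)ˣ).map
          (Herbrand.norm (κ.layer 1 ≃ₐ[K] κ.layer 1))).relIndex
        (unitsE (κ.layer 1) ⊓ (unitsIncl K (κ.layer 1)).range) * p = p ^ s) :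
    ClassicalMuVanishes κ :=
  classicalMuVanishes_of_eventually_const κ (c := 0) (n₀ := 0)
    fun n _ => classNumberPExp_eq_zero_of_relIndex_mul_eq hF1 hp2 κ hram hK hs hidx n

/-- **Consumer form for the `μ`-roads** («`∀ κ` cyclotomic on `K`, `ClassicalMuVanishes κ`»): granted
Fukuda's Thm. 1 (1), if `p` is odd, `p ∤ h_K`, `K` has `s` primes above `p`, and EVERY cyclotomic
`ℤ_p`-extension `κ` of `K` has Fukuda's index `0` and first-layer unit norm index `p^{s-1}`, then every
cyclotomic `κ` has `μ = 0` — exactly the `hμ`-inputs of `classicalMuVanishes_of_isCyclotomic_of_normRelation`,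
`…_of_kuroda_rat`, `…_of_relative_biquadratic` etc.  (All cyclotomic `κ` on `K` have the same kernel and the
same layers; the hypotheses are stated per `κ` only to match those consumers.)
[cite: Lang1990, Ch. 13 §4, Lemma 4.1 (PDF p. 203)] [cite: Fukuda1994, Thm. 1 (1), p. 264] -/
theorem forall_classicalMuVanishes_of_relIndex_mul_eq
    (hF1 : fukuda1994_thm1_classNumberPExp_const_of_succ_eq) (hp2 : p ≠ 2) (hK : ¬ p ∣ classNumber K)
    {s : ℕ} (hs : {v : HeightOneSpectrum (𝓞 K) | ((p : ℕ) : 𝓞 K) ∈ v.asIdeal}.ncard = s)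
    (hram : ∀ κ : ZpExtension K p, κ.IsCyclotomic → TotallyRamifiedFrom κ 0)
    (hidx : ∀ κ : ZpExtension K p, κ.IsCyclotomic →
      haveI : FiniteDimensional K (κ.layer 1) := κ.finiteDimensional_layer_holds 1
      (unitsE (κ.layer 1) ⊓ (⊤ : Subgroup (κ.layer 1)ˣ).map
          (Herbrand.norm (κ.layer 1 ≃ₐ[K] κ.layer 1))).relIndex
        (unitsE (κ.layer 1) ⊓ (unitsIncl K (κ.layer 1)).range) * p = p ^ s) :
    ∀ κ : ZpExtension K p, κ.IsCyclotomic → ClassicalMuVanishes κ :=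
  fun κ hκ => classicalMuVanishes_of_relIndex_mul_eq hF1 hp2 κ (hram κ hκ) hK hs (hidx κ hκ)

end Literature.NumberTheory.IwasawaTheory

end
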